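import Summits.HodgeConjecture.HodgeConjecture.Theses.NikulinTwinTransport
import Summits.HodgeConjecture.HodgeConjecture.Theorems.NikulinTwinTransportTwinSimilitudeAlgebraicLattice
import Literature.AlgebraicGeometry.Surfaces.K3SurfaceProofs
import Literature.AlgebraicGeometry.HodgeTheory.SupportedClassesRationalProofs
import Literature.LinearAlgebra.QuadraticForm.WittExtension
import Mathlib.LinearAlgebra.BilinearForm.Orthogonal
import Mathlib.LinearAlgebra.Projection

/-!
# Route NikulinTwinTransport · `RealMultiplicationSqrtTwoAlgebraic` (stmt-HodgeConjecture-13679) —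
# the linear-algebra core: real multiplication extends to a rational `2`-similitude (Witt)

Item stmt-HodgeConjecture-13679 ("THE DELIVERABLE" of route NikulinTwinTransport): for a projective
K3 surface `S` and a rational, type-preserving, cup-self-adjoint endomorphism `e` of `H²(S(ℂ); ℂ)`
killing `NS(S) := algebraicClasses S 1` with `e² = 2` on `NS(S)^⊥` (real multiplication by `√2`
on `T(S)`), the class of `e` is algebraic. Standalone this is an open sub-case of the Hodge
conjecture; the sibling file `NikulinTwinTransportRealMultiplicationSqrtTwoAlgebraic` reduces it to
the route's target X = Sim₂(K3) AT THE PAIR `(S, S)` plus divisor correspondences, by writing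
`e = Ξ − ν̃` with `Ξ` a rational Hodge `2`-SIMILITUDE OF `H²(S)` ITSELF and `ν̃` a sum of products
of divisors. This file is the linear algebra of that reduction, kernel-checked:

* `exists_similitude_extension` — over any field of characteristic `≠ 2`: if `(V, B)` is
  non-degenerate and admits a self-similitude of multiplier `r ≠ 0`, `N ≤ V`, and `ε` is
  `B`-self-adjoint, kills `N` and has `ε² = r` on `T = N^⊥`, then `N ∩ T = 0` and some `g` with
  image in `N` and kernel `⊇ T` makes `ε + g` a similitude of multiplier `r`. The point: `ε|_T`
  is an isometric embedding `(T, rB) ↪ (V, B)`, which Witt's extension theorem (the tree's PROVED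
  `Literature.LinearAlgebra.QuadraticForm.Witt_isometry_extension_holds`, Iversen Ch. I Thm. 2.4)
  extends along `(V, rB) ≅ (V, B)`; the extension carries `N = T^⊥` into `N` ("Witt cancellation
  over `ℚ`", the formal debt named by the route for `RealMultiplicationGlue`, Huybrechts 2019 §1).
* `exists_eq_sum_rankOne` — a map with image in `N` killing `N^⊥` is `x ↦ Σᵢ B(x, aᵢ) bᵢ` with
  `aᵢ, bᵢ ∈ N` (so the correction is a sum of "products of divisors").
* `exists_twoSimilitude_k3FormRat` — `Λ_ℚ(2) ≅ Λ_ℚ` for the K3 lattice, the `ℚ`-form of the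
  explicit `2`-similitude `exists_twoSimilitude_k3Lattice` (sum/difference on `E₈(−1)^{⊕2}`,
  `diag(1,2)` on each `U`); `k3Form_of_ratRestriction` — a similitude of `Λ_ℚ` complexifies to one
  of `Λ_ℂ`.
* `exists_ratCorrection` — the K3 statement: for a marked projective K3 surface (`η`, `p₀`, as
  in `Huybrechts_K3_marking_exists`) and `e` as in the item, there are `aᵢ, bᵢ ∈ Λ_ℚ` with
  `η⁻¹aᵢ, η⁻¹bᵢ ∈ NS(S)` and a rational `2`-similitude `ξ` of `Λ_ℚ` with
  `η (e + ν̃) η⁻¹ = ξ` on `Λ_ℚ`, `ν̃ x = Σᵢ (ηx.aᵢ) η⁻¹bᵢ` (read `e` through `η` as a `ℚ`-linear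
  `ε`: rational classes are `Λ_ℚ` by `isRationalClass_iff_of_marking`, `NS` is spanned by its
  rational classes by the proved `span_isRationalClass_eq_top_of_isSmoothProjective_holds`).

Sources: Varesco, Math. Z. 305 (2023) Thm. 2.1 / Rem. 2.2 (the factorisation idea); Huybrechts,
Comment. Math. Helv. 94 (2019) §1 (Witt over `Λ_{K3} ⊗ ℚ`); Iversen, *Hyperbolic Geometry* (1992)
Ch. I Thm. 2.4. Prover seat prover-HodgeConjecture-route-HodgeConjecture-NikulinTwinTransport-3.
-/

namespace Summit.HodgeConjecture.HodgeConjecture.Theorems.NikulinTwinTransport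

open scoped Manifold
open Module CategoryTheory MonoidalCategory
open Literature.LinearAlgebra.QuadraticForm
open Literature.AlgebraicGeometry.Motives Literature.AlgebraicGeometry.HodgeTheory
open Literature.AlgebraicGeometry.Surfaces
open Literature.AlgebraicTopology.SingularHomology

/-! ### Over a field of characteristic `≠ 2`: Witt -/

section Field

variable {K : Type*} [Field K] {V : Type*} [AddCommGroup V] [Module K V] [FiniteDimensional K V]

/-- **Extension of real multiplication to a similitude (Witt).** Let `B` be a symmetric
non-degenerate bilinear form on a finite-dimensional `K`-space `V` (`char K ≠ 2`) admitting a
self-similitude `M` of multiplier `r ≠ 0` (`B(Mx,My) = r B(x,y)`), `N ≤ V` a subspace and `ε` a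
`B`-self-adjoint endomorphism killing `N` with `ε² = r` on `T = N^⊥`. Then `N ∩ T = 0`, and there
is an endomorphism `g` with image in `N` and killing `T` such that `Ξ = ε + g` is a similitude of
`V` of multiplier `r`. Proof: `ε|_T : (T, rB) → (V, B)` is an injective isometric embedding and
`M : (V, rB) ⥲ (V, B)` an isometry, so by Witt's extension theorem
(`Witt_isometry_extension_holds`) some `τ : (V, rB) ⥲ (V, B)` restricts to `ε` on `T`; it carries
`N = T^⊥` into `(εT)^⊥ = T^⊥ = N`, and `g := τ ∘ pr_N` works. [cite: Iversen1992, Ch. I §2 Thm. 2.4]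
[cite: Huybrechts2019, §1] -/
theorem exists_similitude_extension [NeZero (2 : K)] {B : LinearMap.BilinForm K V}
    (hB : B.IsSymm) (hBn : B.Nondegenerate) {r : K} (hr : r ≠ 0)
    (M : V →ₗ[K] V) (hM : ∀ x y, B (M x) (M y) = r * B x y)
    (N : Submodule K V) (ε : V →ₗ[K] V)
    (hεadj : ∀ x y, B (ε x) y = B x (ε y))
    (hεN : ∀ n ∈ N, ε n = 0)
    (hεT : ∀ t ∈ B.orthogonal N, ε (ε t) = r • t) :
    Disjoint N (B.orthogonal N) ∧
    ∃ g : V →ₗ[K] V, (∀ x, g x ∈ N) ∧ (∀ t ∈ B.orthogonal N, g t = 0) ∧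
      ∀ x y, B ((ε + g) x) ((ε + g) y) = r * B x y := by
  classical
  have h2 : (2 : K) ≠ 0 := NeZero.ne 2
  have hBr : B.IsRefl := hB.isRefl
  set T := B.orthogonal N with hTdef
  -- `N ∩ T = 0`: on the intersection `ε = 0` and `ε² = r`.
  have hdisj : Disjoint N T := by
    rw [Submodule.disjoint_def]
    intro n hn hnT
    have h1 : ε (ε n) = r • n := hεT n hnT
    rw [hεN n hn, map_zero] at h1
    exact (smul_eq_zero.1 h1.symm).resolve_left hr
  have hc : IsCompl N T := (LinearMap.BilinForm.isCompl_orthogonal_iff_disjoint hBr).2 hdisj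
  have hTT : B.orthogonal T = N := LinearMap.BilinForm.orthogonal_orthogonal hBn hBr N
  -- `ε` maps `T` into `T`, and `ε|_T` is injective
  have hεTT : ∀ t ∈ T, ε t ∈ T := fun t ht => by
    rw [LinearMap.BilinForm.mem_orthogonal_iff]
    intro n hn
    rw [← hεadj, hεN n hn, map_zero, LinearMap.zero_apply]
  refine ⟨hdisj, ?_⟩
  -- Witt: extend `ε|_T : (T, rB) → (V, B)` along the isometry `M : (V, rB) → (V, B)`.
  have hMinj : Function.Injective M := by
    rw [← LinearMap.ker_eq_bot, LinearMap.ker_eq_bot']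
    intro x hx
    refine hBn.1 x fun y => ?_
    have h := hM x y
    rw [hx, map_zero, LinearMap.zero_apply] at h
    exact (mul_eq_zero.1 h.symm).resolve_left hr
  let Me : V ≃ₗ[K] V := LinearEquiv.ofBijective M ⟨hMinj, LinearMap.injective_iff_surjective.1 hMinj⟩
  have hrB : (r • B).IsSymm := ⟨fun x y => by
    simp only [LinearMap.smul_apply, hB.eq x y]⟩
  have hrBn : (r • B).Nondegenerate := by
    refine ⟨fun x hx => hBn.1 x fun y => ?_, fun y hy => hBn.2 y fun x => ?_⟩
    · have h := hx y
      simp only [LinearMap.smul_apply, smul_eq_mul] at h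
      exact (mul_eq_zero.1 h).resolve_left hr
    · have h := hy x
      simp only [LinearMap.smul_apply, smul_eq_mul] at h
      exact (mul_eq_zero.1 h).resolve_left hr
  have hσinj : Function.Injective (ε ∘ₗ T.subtype) := by
    rw [← LinearMap.ker_eq_bot, LinearMap.ker_eq_bot']
    intro t ht
    have h1 : ε (ε (t : V)) = r • (t : V) := hεT t t.2
    rw [LinearMap.comp_apply, Submodule.subtype_apply] at ht
    rw [ht, map_zero] at h1
    exact_mod_cast (smul_eq_zero.1 h1.symm).resolve_left hr
  have hσB : ∀ x y : T, B ((ε ∘ₗ T.subtype) x) ((ε ∘ₗ T.subtype) y) = (r • B) x y := fun x y => by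
    simp only [LinearMap.comp_apply, Submodule.subtype_apply, LinearMap.smul_apply, smul_eq_mul]
    rw [hεadj, hεT _ y.2, map_smul, smul_eq_mul]
  obtain ⟨τ, hτB, hτT⟩ := Witt_isometry_extension.exists_extension_of_equiv
    Witt_isometry_extension_holds h2 (r • B) B hrB hrBn Me
    (fun x y => by
      show B (M x) (M y) = (r • B) x y
      rw [hM, LinearMap.smul_apply, LinearMap.smul_apply, smul_eq_mul])
    T (ε ∘ₗ T.subtype) hσinj hσB
  -- `τ` carries `N = T^⊥` into `N`
  have hτN : ∀ n ∈ N, τ n ∈ N := by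
    intro n hn
    rw [← hTT, LinearMap.BilinForm.mem_orthogonal_iff]
    intro t ht
    -- `t = ε (ε (r⁻¹ t)) = τ (ε (r⁻¹ t))`
    have ht' : r⁻¹ • t ∈ T := T.smul_mem _ ht
    have hεt' : ε (r⁻¹ • t) ∈ T := hεTT _ ht'
    have ht_eq : t = τ (ε (r⁻¹ • t)) := by
      have h1 := hτT ⟨ε (r⁻¹ • t), hεt'⟩
      rw [LinearMap.comp_apply, Submodule.subtype_apply] at h1
      rw [h1, hεT _ ht', smul_smul, mul_inv_cancel₀ hr, one_smul]
    rw [ht_eq, hτB, LinearMap.smul_apply, LinearMap.smul_apply, smul_eq_mul]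
    have h0 : B (ε (r⁻¹ • t)) n = 0 := by
      rw [hB.eq]; exact hεt' n hn
    rw [h0, mul_zero]
  -- the correction `g := τ ∘ pr_N`
  refine ⟨τ.toLinearMap ∘ₗ N.projection T hc, fun x => hτN _ (Submodule.projection_apply_mem hc x),
    fun t ht => ?_, fun x y => ?_⟩
  · rw [LinearMap.comp_apply, Submodule.projection_apply_of_mem_right hc ht, LinearEquiv.coe_coe,
      map_zero]
  · obtain ⟨n, hn, t, ht, rfl⟩ :=
      Submodule.mem_sup.1 (show x ∈ N ⊔ T by rw [hc.sup_eq_top]; exact Submodule.mem_top)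
    obtain ⟨n', hn', t', ht', rfl⟩ :=
      Submodule.mem_sup.1 (show y ∈ N ⊔ T by rw [hc.sup_eq_top]; exact Submodule.mem_top)
    have hg : ∀ a ∈ N, ∀ b ∈ T, (ε + τ.toLinearMap ∘ₗ N.projection T hc) (a + b) = ε b + τ a := by
      intro a ha b hb
      rw [LinearMap.add_apply, LinearMap.comp_apply, LinearEquiv.coe_coe, map_add, map_add,
        hεN a ha, zero_add, Submodule.projection_apply_of_mem_left hc ha,
        Submodule.projection_apply_of_mem_right hc hb, add_zero]
    rw [hg n hn t ht, hg n' hn' t' ht']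
    have o1 : ∀ a ∈ N, ∀ b ∈ T, B a b = 0 := fun a ha b hb => hb a ha
    have o2 : ∀ a ∈ N, ∀ b ∈ T, B b a = 0 := fun a ha b hb => by rw [hB.eq]; exact hb a ha
    have hτn : τ n ∈ N := hτN n hn
    have hτn' : τ n' ∈ N := hτN n' hn'
    have hεt : ε t ∈ T := hεTT t ht
    have hεt' : ε t' ∈ T := hεTT t' ht'
    simp only [map_add, LinearMap.add_apply]
    rw [o2 _ hτn' _ hεt, o1 _ hτn _ hεt', hτB, LinearMap.smul_apply, LinearMap.smul_apply,
      smul_eq_mul, hεadj, hεT t' ht', map_smul, smul_eq_mul, o1 n hn t' ht', o2 n' hn' t ht]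
    ring

/-- **An endomorphism with image in `N` killing `N^⊥` is a finite sum of rank-one maps
`x ↦ B(x, aᵢ) bᵢ` with `aᵢ, bᵢ ∈ N`** (`B` symmetric non-degenerate, `V` finite-dimensional):
expand in a basis `(bᵢ)` of `N`; each coordinate functional of `g` kills `N^⊥`, hence is
`B(·, aᵢ)` for some `aᵢ ∈ N^⊥⊥ = N`. (For the K3 route: the correction `ν̃ = ν ∘ pr_{NS}` is a sum of
"products of divisors" `x ↦ (x.aᵢ) bᵢ`.) [folklore] -/
theorem exists_eq_sum_rankOne {B : LinearMap.BilinForm K V} (hB : B.IsSymm) (hBn : B.Nondegenerate)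
    (N : Submodule K V) (g : V →ₗ[K] V) (hgN : ∀ x, g x ∈ N)
    (hgT : ∀ t ∈ B.orthogonal N, g t = 0) :
    ∃ (m : ℕ) (a b : Fin m → V), (∀ i, a i ∈ N) ∧ (∀ i, b i ∈ N) ∧
      ∀ x, g x = ∑ i, B x (a i) • b i := by
  classical
  have hBr : B.IsRefl := hB.isRefl
  let bN := Module.finBasis K N
  let g' : V →ₗ[K] N := LinearMap.codRestrict N g hgN
  let φ : Fin (finrank K N) → Module.Dual K V := fun i => (bN.coord i) ∘ₗ g'
  let a : Fin (finrank K N) → V := fun i => (B.toDual hBn).symm (φ i)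
  have ha : ∀ i x, B (a i) x = φ i x := fun i x =>
    LinearMap.BilinForm.apply_toDual_symm_apply (hB := hBn) (f := φ i) (v := x)
  refine ⟨finrank K N, a, fun i => (bN i : V), fun i => ?_, fun i => (bN i).2, fun x => ?_⟩
  · -- `aᵢ ∈ N^⊥⊥ = N`
    rw [← LinearMap.BilinForm.orthogonal_orthogonal hBn hBr N, LinearMap.BilinForm.mem_orthogonal_iff]
    intro t ht
    rw [hB.eq, ha, LinearMap.comp_apply]
    have h0 : g' t = 0 := Subtype.ext (by simpa [g'] using hgT t ht)
    rw [h0, map_zero]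
  · have hsum := bN.sum_repr (g' x)
    have hcoe : (g x : V) = ((g' x : N) : V) := rfl
    rw [hcoe, ← hsum, Submodule.coe_sum]
    refine Finset.sum_congr rfl fun i _ => ?_
    rw [Submodule.coe_smul, hB.eq, ha]
    rfl

end Field

/-! ### `Λ_ℚ ⊂ Λ_ℂ`: casting lemmas -/

/-- `Λ_ℚ ⊂ Λ_ℂ` is additive. [folklore] -/
theorem ratCastΛ_add (u v : K3Index → ℚ) :
    (fun i => ((u + v) i : ℂ)) = (fun i => (u i : ℂ)) + fun i => (v i : ℂ) := by
  funext i; simp only [Pi.add_apply, Rat.cast_add]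

/-- `Λ_ℚ ⊂ Λ_ℂ` is compatible with rational scalars. [folklore] -/
theorem ratCastΛ_smul (q : ℚ) (u : K3Index → ℚ) :
    (fun i => ((q • u) i : ℂ)) = (q : ℂ) • fun i => (u i : ℂ) := by
  funext i; simp only [Pi.smul_apply, smul_eq_mul, Rat.cast_mul]

/-- `Λ_ℚ ⊂ Λ_ℂ` is injective. [folklore] -/
theorem ratCastΛ_injective {u v : K3Index → ℚ}
    (h : (fun i => (u i : ℂ)) = fun i => (v i : ℂ)) : u = v := by
  funext i
  exact Rat.cast_injective (congrFun h i)

/-- `Λ_ℚ ⊂ Λ_ℂ` commutes with finite sums. [folklore] -/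
theorem ratCastΛ_sum {ι : Type*} (s : Finset ι) (u : ι → K3Index → ℚ) :
    (fun i => ((∑ j ∈ s, u j) i : ℂ)) = ∑ j ∈ s, fun i => (u j i : ℂ) := by
  funext i; simp only [Finset.sum_apply, Rat.cast_sum]

/-- The zero vector of `Λ_ℚ` is the zero vector of `Λ_ℂ`. [folklore] -/
theorem ratCastΛ_zero : (fun i : K3Index => (((0 : K3Index → ℚ) i : ℚ) : ℂ)) = 0 := by
  funext i; simp

/-- The standard basis of `Λ_ℂ` consists of rational vectors. [folklore] -/
theorem basisFun_eq_ratCastΛ (j : K3Index) :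
    (Pi.basisFun ℂ K3Index) j = fun i => ((Pi.single j (1 : ℚ) : K3Index → ℚ) i : ℂ) := by
  rw [Pi.basisFun_apply]
  funext i
  by_cases hij : i = j
  · subst hij; simp only [Pi.single_eq_same, Rat.cast_one]
  · simp only [Pi.single_apply, if_neg hij, Rat.cast_zero]

/-- **A similitude of `Λ_ℚ` complexifies to a similitude of `Λ_ℂ`**: if a `ℂ`-linear `Ξ` restricts
on `Λ_ℚ` to a `ℚ`-linear `ξ` multiplying the rational K3 form by `r`, then `Ξ` multiplies the
complex K3 form by `r` (both sides are `ℂ`-bilinear and agree on the rational standard basis).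
[folklore] -/
theorem k3Form_of_ratRestriction (Ξ : Module.End ℂ (K3Index → ℂ)) (ξ : Module.End ℚ (K3Index → ℚ))
    (hΞ : ∀ u : K3Index → ℚ, Ξ (fun i => (u i : ℂ)) = fun i => (ξ u i : ℂ)) (r : ℚ)
    (hξ : ∀ u v, k3FormRat (ξ u) (ξ v) = r * k3FormRat u v) (a b : K3Index → ℂ) :
    k3Form (Ξ a) (Ξ b) = (r : ℂ) * k3Form a b := by
  have h : k3FormC.compl₁₂ Ξ Ξ = (r : ℂ) • k3FormC := by
    refine LinearMap.ext_basis (Pi.basisFun ℂ K3Index) (Pi.basisFun ℂ K3Index) fun i j => ?_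
    rw [basisFun_eq_ratCastΛ, basisFun_eq_ratCastΛ, LinearMap.compl₁₂_apply, LinearMap.smul_apply,
      LinearMap.smul_apply, k3FormC_apply, k3FormC_apply, hΞ, hΞ, k3Form_ratCast, k3Form_ratCast, hξ,
      Rat.cast_mul, smul_eq_mul]
  have h' := LinearMap.congr_fun₂ h a b
  rw [LinearMap.compl₁₂_apply, LinearMap.smul_apply, LinearMap.smul_apply, k3FormC_apply, k3FormC_apply,
    smul_eq_mul] at h'
  exact h'

/-- **The explicit rational `2`-similitude of the K3 lattice, over `ℚ`**: there is a `ℚ`-linear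
endomorphism `M` of `Λ_ℚ` with `(Ma.Mb) = 2 (a.b)` (from `exists_twoSimilitude_k3Lattice`).
[folklore] -/
theorem exists_twoSimilitude_k3FormRat :
    ∃ M : Module.End ℚ (K3Index → ℚ), ∀ a b, k3FormRat (M a) (M b) = 2 * k3FormRat a b := by
  obtain ⟨M, -, hMrat, -, -, -, hM2⟩ := exists_twoSimilitude_k3Lattice
  obtain ⟨τ, hτ⟩ := exists_ratEnd_of_forall_intCast M hMrat
  refine ⟨τ, fun a b => Rat.cast_injective (α := ℂ) ?_⟩
  rw [Rat.cast_mul, ← k3Form_ratCast, ← k3Form_ratCast, ← hτ a, ← hτ b, hM2, Rat.cast_ofNat]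


/-! ### Real multiplication read through a marking: the rational data -/

section Marked

variable {S : SchemeOver ℂ}

/-- **The rational correction of real multiplication (through a marking).** Let `S` be a projective
K3 surface with a marking `η : H²(S(ℂ); ℂ) ≅ Λ_ℂ` (integral classes `↔ Λ`, `a ∪ b = (ηa.ηb) p₀`,
`p₀ ≠ 0`), `N = N¹H²` its algebraic classes, and `e` a rational, cup-self-adjoint endomorphism of
`H²(S(ℂ); ℂ)` killing `N` with `e² = 2` on `N^⊥`. Then there are rational vectors `aᵢ, bᵢ ∈ Λ_ℚ`
with `η⁻¹aᵢ, η⁻¹bᵢ ∈ N` and a `ℚ`-linear `ξ` of `Λ_ℚ` multiplying the K3 form by `2`, such that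
`η ∘ (e + ν̃) ∘ η⁻¹` restricts to `ξ` on `Λ_ℚ`, where `ν̃ x = Σᵢ (ηx.aᵢ) η⁻¹bᵢ`. Proof: read `e`
through `η` as a `ℚ`-linear `ε` of `Λ_ℚ` (rational classes `= Λ_ℚ`), self-adjoint for the rational
K3 form, killing `N_ℚ` and with `ε² = 2` on `N_ℚ^⊥` (`N` is spanned by its rational classes);
apply `exists_similitude_extension` with the lattice `2`-similitude `exists_twoSimilitude_k3FormRat`
(Witt) and expand the correction in rank-one maps (`exists_eq_sum_rankOne`).
[cite: Huybrechts2019, §1] [cite: Varesco2023, Thm. 2.1 and Rem. 2.2] -/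
theorem exists_ratCorrection (hS : IsK3Surface S)
    (η : complexBetti S (2 * 1) ≃ₗ[ℂ] (K3Index → ℂ)) (p₀ : complexBetti S (2 * 2)) (hp₀ : p₀ ≠ 0)
    (hηint : ∀ c : complexBetti S (2 * 1), IsIntegralClass c ↔ ∃ v : K3Index → ℤ, η c = fun i => (v i : ℂ))
    (hηcup : ∀ a b : complexBetti S (2 * 1),
      cupProduct (rfl : 2 * 1 + 2 * 1 = 2 * 2) a b = k3Form (η a) (η b) • p₀)
    (e : complexBetti S (2 * 1) →ₗ[ℂ] complexBetti S (2 * 1))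
    (he_rat : ∀ x, IsRationalClass x → IsRationalClass (e x))
    (he_adj : ∀ x y : complexBetti S (2 * 1),
      cupProduct (rfl : 2 * 1 + 2 * 1 = 2 * 2) (e x) y = cupProduct (rfl : 2 * 1 + 2 * 1 = 2 * 2) x (e y))
    (he_N : ∀ d ∈ algebraicClasses S 1, e d = 0)
    (he_T : ∀ x : complexBetti S (2 * 1),
      (∀ d ∈ algebraicClasses S 1, cupProduct (rfl : 2 * 1 + 2 * 1 = 2 * 2) x d = 0) → e (e x) = (2 : ℂ) • x) :
    ∃ (m : ℕ) (a b : Fin m → K3Index → ℚ) (ξ : Module.End ℚ (K3Index → ℚ)),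
      (∀ i, η.symm (fun j => (a i j : ℂ)) ∈ algebraicClasses S 1) ∧
      (∀ i, η.symm (fun j => (b i j : ℂ)) ∈ algebraicClasses S 1) ∧
      (∀ u v, k3FormRat (ξ u) (ξ v) = 2 * k3FormRat u v) ∧
      ∀ u : K3Index → ℚ,
        η (e (η.symm fun j => (u j : ℂ))) +
            ∑ i, k3Form (fun j => (u j : ℂ)) (fun j => (a i j : ℂ)) • (fun j => (b i j : ℂ)) =
          fun j => (ξ u j : ℂ) := by
  classical
  set N := algebraicClasses S 1 with hNdef
  -- `e` read through the marking is a `ℚ`-linear endomorphism `ε` of `Λ_ℚ`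
  obtain ⟨ε, hε⟩ := exists_ratEnd_of_forall_intCast (η.toLinearMap ∘ₗ e ∘ₗ η.symm.toLinearMap)
    (markingConj_intCast hS η hηint η hηint e he_rat)
  have hε' : ∀ u : K3Index → ℚ, η (e (η.symm fun j => (u j : ℂ))) = fun j => (ε u j : ℂ) := fun u => by
    simpa only [LinearMap.coe_comp, LinearEquiv.coe_coe, Function.comp_apply] using hε u
  have hεx : ∀ u : K3Index → ℚ, e (η.symm fun j => (u j : ℂ)) = η.symm fun j => (ε u j : ℂ) := fun u => by
    rw [← hε' u, LinearEquiv.symm_apply_apply]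
  -- the rational points of `N`
  let NQ : Submodule ℚ (K3Index → ℚ) :=
    { carrier := {u | η.symm (fun j => (u j : ℂ)) ∈ N}
      add_mem' := fun {u v} hu hv => by
        simp only [Set.mem_setOf_eq, ratCastΛ_add, map_add]
        exact N.add_mem hu hv
      zero_mem' := by
        simp only [Set.mem_setOf_eq, ratCastΛ_zero, map_zero]
        exact N.zero_mem
      smul_mem' := fun q u hu => by
        simp only [Set.mem_setOf_eq, ratCastΛ_smul, map_smul]
        exact N.smul_mem _ hu }
  have memNQ : ∀ u, u ∈ NQ ↔ η.symm (fun j => (u j : ℂ)) ∈ N := fun u => Iff.rfl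
  -- injectivity of `c ↦ c • p₀`
  have hsmul : ∀ {c c' : ℂ}, c • p₀ = c' • p₀ → c = c' := fun h => smul_left_injective ℂ hp₀ h
  -- (adj) `ε` is self-adjoint for the rational K3 form
  have hadj : ∀ u v, k3FormRat (ε u) v = k3FormRat u (ε v) := by
    intro u v
    apply Rat.cast_injective (α := ℂ)
    rw [← k3Form_ratCast, ← k3Form_ratCast, ← hε' u, ← hε' v]
    have h := he_adj (η.symm fun j => (u j : ℂ)) (η.symm fun j => (v j : ℂ))
    rw [hηcup, hηcup, LinearEquiv.apply_symm_apply, LinearEquiv.apply_symm_apply] at h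
    exact hsmul h
  -- (N) `ε` kills `N_ℚ`
  have hN : ∀ u ∈ NQ, ε u = 0 := by
    intro u hu
    apply ratCastΛ_injective
    rw [← hε' u, he_N _ ((memNQ u).1 hu), map_zero, ratCastΛ_zero]
  -- `N` is spanned by its rational classes, so `N_ℚ^⊥ ⊗ ℂ ⊆ N^⊥`
  have hspan := span_isRationalClass_eq_top_of_isSmoothProjective_holds.supportedClasses_eq_span
    hS.1 (2 * 1) 1
  have horth : ∀ u ∈ k3FormRat.orthogonal NQ, ∀ d ∈ N, k3Form (fun j => (u j : ℂ)) (η d) = 0 := by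
    intro u hu d hd
    rw [LinearMap.BilinForm.mem_orthogonal_iff] at hu
    have hd' : d ∈ Submodule.span ℂ {c : complexBetti S (2 * 1) |
        IsRationalClass c ∧ c ∈ supportedClasses S (2 * 1) 1} := by
      rw [← hspan]; exact hd
    clear hd
    induction hd' using Submodule.span_induction with
    | mem d hd =>
      obtain ⟨w, hw⟩ := (isRationalClass_iff_of_marking hS η hηint d).1 hd.1
      have hwN : w ∈ NQ := by
        rw [memNQ, ← hw, LinearEquiv.symm_apply_apply]
        exact hd.2
      rw [hw, k3Form_ratCast, k3FormRat_isSymm.eq, hu w hwN, Rat.cast_zero]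
    | zero => rw [map_zero, k3Form_zero_right]
    | add c c' _ _ hc hc' => rw [map_add, k3Form_add_right, hc, hc', add_zero]
    | smul t c _ hc => rw [map_smul, k3Form_smul_right, hc, mul_zero]
  -- (T) `ε² = 2` on `N_ℚ^⊥`
  have hT : ∀ u ∈ k3FormRat.orthogonal NQ, ε (ε u) = (2 : ℚ) • u := by
    intro u hu
    have hx : ∀ d ∈ algebraicClasses S 1,
        cupProduct (rfl : 2 * 1 + 2 * 1 = 2 * 2) (η.symm fun j => (u j : ℂ)) d = 0 := fun d hd => by
      rw [hηcup, LinearEquiv.apply_symm_apply, horth u hu d hd, zero_smul]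
    have h2 := he_T _ hx
    rw [hεx, hεx, ← LinearEquiv.map_smul, ← Rat.cast_ofNat, ← ratCastΛ_smul] at h2
    exact ratCastΛ_injective (η.symm.injective h2)
  -- Witt: extend to a `2`-similitude, then expand the correction in rank-one maps
  obtain ⟨M, hM⟩ := exists_twoSimilitude_k3FormRat
  obtain ⟨-, g, hgN, hgT, hsim⟩ := exists_similitude_extension k3FormRat_isSymm k3FormRat_nondegenerate
    (two_ne_zero (α := ℚ)) M hM NQ ε hadj hN hT
  obtain ⟨m, a, b, ha, hb, hg⟩ :=
    exists_eq_sum_rankOne k3FormRat_isSymm k3FormRat_nondegenerate NQ g hgN hgT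
  refine ⟨m, a, b, ε + g, fun i => (memNQ _).1 (ha i), fun i => (memNQ _).1 (hb i), hsim, fun u => ?_⟩
  rw [hε' u, LinearMap.add_apply, ratCastΛ_add, hg u, ratCastΛ_sum]
  congr 1
  refine Finset.sum_congr rfl fun i _ => ?_
  rw [ratCastΛ_smul, k3Form_ratCast]

end Marked

end Summit.HodgeConjecture.HodgeConjecture.Theorems.NikulinTwinTransport
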